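import Literature.NumberTheory.EllipticCurves.VeluDiscriminantProofs
import Literature.NumberTheory.EllipticCurves.DivisionPolynomialMultiplication
import Literature.NumberTheory.EllipticCurves.EllipticNetPeriodic
import Literature.NumberTheory.EllipticCurves.EllipticNetPeriodicProductsProofs
import Mathlib.FieldTheory.IsAlgClosed.AlgebraicClosure
import HarnessLib

/-!
# Coates' lemma in Vélu form: `Δ(E)ⁿ = Δ(E/⟨P⟩) · g¹²` for a point `P` of order `n` prime to `6`
# (Dokchitser–Dokchitser 2015, Thm. 3, algebraic proof for every cyclic kernel; proofs only)

Topic `NumberTheory/EllipticCurves`; THEOREMS ONLY; sequel of `VeluDiscriminantProofs.lean`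
(`Δ(E/G)·Π_{v ∈ G∖O}(2y(v))⁴ = Δ(E)^{#G}`) and `EllipticNetPeriodicProductsProofs.lean`
(`(Π W(2k))³² = (Π W(3k))¹²·(Π W(k))²⁰` for a Ward-periodic sequence). For a short Weierstrass
elliptic curve `E : y² = x³ + a₄x + a₆` over a field `F` of characteristic `0`, a point `P ∈ E(F)`
of exact order `n = 2m + 1` prime to `3`, `G = ⟨P⟩` and Vélu's quotient
`E/G : y² = x³ + a'x + b'`: `ψ₂_zsmul_mul_pow_four` (`ψ₂(kP)·ψ_k(P)⁴ = ψ_{2k}(P)`),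
`xOf_zsmul_sub_mul` (`(x(kP) - x(2kP))·ψ_kψ_{2k}² = ψ_{3k}`), `prod_ψ_two_mul_pow_eq`
(`(Π_{k≤m} ψ_{2k}(P))³² = (Π ψ_{3k}(P))¹²·(Π ψ_k(P))²⁰`, Ward's symmetry for the division values
over an algebraic closure), `prod_ψ₂_zsmul_sq_pow_four`
(**`(Π_{k≤m} ψ₂(kP)²)⁴ = (Π_{k≤m}(x(kP) - x(2kP)))¹²`**), and
**`veluDelta_mul_prod_sub_pow_twelve`: `Δ(E/⟨P⟩)·(Π_{k=1}^{m}(x(kP) - x(2kP)))¹² = Δ(E)ⁿ`.**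
So `Δ(E)ⁿ/Δ(E/⟨P⟩)` is the `12`-th power of `g = Π_{k ≤ m}(x(kP) - x(2kP))`, a symmetric function
of the kernel: J. Coates' lemma (Bull. LMS 23 (1991), appendix, Thm. 8) = Dokchitser–Dokchitser
2015 §2 Thm. 3, printed for a prime degree `p > 3` with an analytic proof (`(η(pτ)^p/η(τ))²`,
`q`-expansion principle); here algebraic and for every cyclic kernel of order prime to `6`
(for `3 ∣ n` it fails: `Δ³/Δ'` is only a `4`-th power, op. cit. Thm. 5; in fact
`g³ = (3/n)·Π_{k≤m}(2y(kP))²` — only its `4`-th power is proved here).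

References: [DokchitserDokchitser2015LocalInvariants] §2 Thm. 3, Table 1; J. Coates, Bull. LMS 23
(1991), appendix Thm. 8 (cited through DD); [Velu1971]; [SilvermanAEC2009] Exercises 3.7, 3.35.
Design: the point is `P = (x₀, y₀)` on `W⁄F` (spelling of `VeluOddKernelProofs`); its order is
given as `nP = 0 ∧ ∀ 0 < k < n, kP ≠ 0`; the kernel finset is `(range n).image (k ↦ k • P)`.
-/

noncomputable section

open scoped Classical

open Polynomial Finset

/-! ### Two identities among the universal division values -/

namespace Literature.NumberTheory.EllipticCurves

namespace UnivEC

/-- **`ψ₂ ∘ [k] = ψ_{2k}/ψ_k⁴` at the universal point**, as the polynomial identity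
`(2ωₖ + A₁φₖψₖ + A₃ψₖ³)·ψₖ = ψ_{2k}` in `U = ℤ[A₁, A₂, A₃, A₄, X, Y]` (`k ≠ 0`): the `y`-coordinate of
`kP` is `ωₖ/ψₖ³` and `2y(kP) + A₁x(kP) + A₃ = ψ_{2k}/ψₖ⁴`. [cite: SilvermanAEC2009, Exercise 3.7(d)] -/
theorem two_mul_ω_add_mul_ψ {k : ℤ} (hk : k ≠ 0) :
    (2 * ω k + A₁ * φ k * ψ k + A₃ * ψ k ^ 3) * ψ k = ψ (2 * k) := by
  apply ι_injective
  have hψ := ιψ_ne_zero hk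
  have hY : 2 * Yn k + ι A₁ * Xn k + ι A₃ = Tn k := by
    rw [Yn]; field_simp; ring
  rw [Tn, Xn] at hY
  simp only [map_add, map_mul, map_pow, map_ofNat, ι_ω hk]
  field_simp at hY
  linear_combination hY

/-- **`x(kP) - x(2kP) = ψ_{3k}/(ψₖψ_{2k}²)` at the universal point**, as the polynomial identity
`φₖψ_{2k}² - φ_{2k}ψₖ² = ψ_{3k}ψₖ` (the elliptic relation `E(2k, k, 1)` with
`φⱼ = Xψⱼ² - ψ_{j+1}ψ_{j-1}`). [cite: SilvermanAEC2009, Exercise 3.7(d)] -/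
theorem φ_mul_ψ_sq_sub (k : ℤ) : φ k * ψ (2 * k) ^ 2 - φ (2 * k) * ψ k ^ 2 = ψ (3 * k) * ψ k := by
  have h := rel₃ (2 * k) k 1
  rw [show 2 * k + k = 3 * k by ring, show 2 * k - k = k by ring, ψ_one, one_pow, mul_one] at h
  rw [φ_def k, φ_def (2 * k)]; linear_combination -h

end UnivEC

end Literature.NumberTheory.EllipticCurves

/-! ### Specialisation to a point: `2y(kP)ψ_k⁴ = ψ_{2k}`, `(x(kP) - x(2kP))ψ_kψ_{2k}² = ψ_{3k}` -/

namespace WeierstrassCurve.Affine.Point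

open Literature.NumberTheory.EllipticCurves

section Specialize

variable {F : Type*} [Field F] {V : WeierstrassCurve F} {x₀ y₀ : F}

/-- **`(2y + a₁x + a₃)(kQ)·ψ_k(Q)⁴ = ψ_{2k}(Q)`** for a nonsingular point `Q = (x₀, y₀)` with
`ψ_k(Q) ≠ 0`. [cite: SilvermanAEC2009, Exercise 3.7(d)] -/
theorem ψ₂_zsmul_mul_pow_four (h : V.toAffine.Nonsingular x₀ y₀) {k : ℤ}
    (hψ : (V.ψ k).evalEval x₀ y₀ ≠ 0) :
    (2 * yOf (k • some x₀ y₀ h) + V.a₁ * xOf (k • some x₀ y₀ h) + V.a₃) *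
        (V.ψ k).evalEval x₀ y₀ ^ 4 = (V.ψ (2 * k)).evalEval x₀ y₀ := by
  have hk : k ≠ 0 := by rintro rfl; simp at hψ
  obtain ⟨hns, e⟩ := zsmul_some_eq_of_evalEval_ψ_ne_zero h hψ
  rw [e, xOf_some, yOf_some]
  have hu := congrArg (UnivEC.ev V x₀ y₀) (UnivEC.two_mul_ω_add_mul_ψ hk)
  simp only [map_mul, map_add, map_pow, map_ofNat, UnivEC.ev_A₁, UnivEC.ev_A₃, UnivEC.map_ψ,
    UnivEC.map_φ, UnivEC.curve_map_ev h.1, UnivEC.ev_xU, UnivEC.ev_yU] at hu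
  rw [show UnivEC.ev V x₀ y₀ (UnivEC.ω k) = ωEval V x₀ y₀ k from rfl] at hu
  rw [← hu]
  field_simp

/-- **`(x(kQ) - x(2kQ))·ψ_k(Q)·ψ_{2k}(Q)² = ψ_{3k}(Q)`** for a nonsingular point `Q = (x₀, y₀)` with
`ψ_k(Q), ψ_{2k}(Q) ≠ 0`. [cite: SilvermanAEC2009, Exercise 3.7(d)] -/
theorem xOf_zsmul_sub_mul (h : V.toAffine.Nonsingular x₀ y₀) {k : ℤ}
    (hψ : (V.ψ k).evalEval x₀ y₀ ≠ 0) (hψ₂ : (V.ψ (2 * k)).evalEval x₀ y₀ ≠ 0) :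
    (xOf (k • some x₀ y₀ h) - xOf ((2 * k) • some x₀ y₀ h)) *
        ((V.ψ k).evalEval x₀ y₀ * (V.ψ (2 * k)).evalEval x₀ y₀ ^ 2) =
      (V.ψ (3 * k)).evalEval x₀ y₀ := by
  obtain ⟨y₁, hns₁, e₁⟩ := zsmul_some_eq_some_φ_div h hψ
  obtain ⟨y₂, hns₂, e₂⟩ := zsmul_some_eq_some_φ_div h hψ₂
  rw [e₁, e₂, xOf_some, xOf_some]
  have hu := congrArg (UnivEC.ev V x₀ y₀) (UnivEC.φ_mul_ψ_sq_sub k)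
  simp only [map_mul, map_sub, map_pow, UnivEC.map_ψ, UnivEC.map_φ, UnivEC.curve_map_ev h.1,
    UnivEC.ev_xU, UnivEC.ev_yU] at hu
  field_simp
  linear_combination (V.ψ (2 * k)).evalEval x₀ y₀ ^ 0 * hu

end Specialize

/-! ### The division values of a point of order `n` prime to `6` -/

section Order

variable {F : Type*} [Field F] {V : WeierstrassCurve F} {x₀ y₀ : F}

/-- **`(Π_{k=1}^{m} ψ_{2k}(P))³² = (Π_{k=1}^{m} ψ_{3k}(P))¹² · (Π_{k=1}^{m} ψ_k(P))²⁰`** for a point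
`P = (x₀, y₀)` of exact order `n = 2m + 1` prime to `3` on a Weierstrass curve over a field: the
division values `k ↦ ψ_k(P)` form an odd elliptic net with rank of apparition `n`
(`ψ_k(P) = 0 ↔ kP = O`), Ward's symmetry theorem (`EllipticNet.exists_periodic`) makes it periodic
up to `αβᵏ`, and the half-system product identity (`EllipticNet.prod_two_mul_pow_eq_of_root`,
applied in an algebraic closure, where `θⁿα = β^m` is solvable) gives the claim.
[cite: SilvermanAEC2009, Exercise 3.35(f) with Exercise 3.7(d),(f)] -/
theorem prod_ψ_two_mul_pow_eq (h : V.toAffine.Nonsingular x₀ y₀) {n m : ℕ} (hnm : n = 2 * m + 1)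
    (h3 : Nat.Coprime 3 n) (h1n : 1 < n) (hn : (n : ℤ) • some x₀ y₀ h = 0)
    (hmin : ∀ k : ℕ, 0 < k → k < n → (k : ℤ) • some x₀ y₀ h ≠ 0) :
    (∏ k ∈ Icc 1 m, (V.ψ ((2 * k : ℕ) : ℤ)).evalEval x₀ y₀) ^ 32 =
      (∏ k ∈ Icc 1 m, (V.ψ ((3 * k : ℕ) : ℤ)).evalEval x₀ y₀) ^ 12 *
        (∏ k ∈ Icc 1 m, (V.ψ k).evalEval x₀ y₀) ^ 20 := by
  set Wk : ℤ → F := fun k => (V.ψ k).evalEval x₀ y₀ with hWk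
  have hzero : ∀ k : ℤ, k • some x₀ y₀ h = 0 ↔ Wk k = 0 := fun k => zsmul_some_eq_zero_iff h k
  have net : IsEllipticNet Wk := fun p q r s => by
    have e := congrArg (evalEvalRingHom x₀ y₀) (V.isEllipticNet_ψ p q r s)
    rw [IsEllipticNet.map_rel, _root_.map_zero] at e
    exact e
  have odd : Function.Odd Wk := fun k => by
    simp only [hWk, WeierstrassCurve.ψ_neg, evalEval_neg]
  have h1 : Wk 1 = 1 := by simp [hWk]
  have hd : Wk n = 0 := (hzero n).mp hn
  have hne : ∀ j : ℤ, 0 < j → j < n → Wk j ≠ 0 := by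
    intro j hj hjn h0
    refine hmin j.toNat (by omega) (by omega) ?_
    rw [Int.toNat_of_nonneg hj.le]
    exact (hzero j).mpr h0
  have hP0 : some x₀ y₀ h ≠ 0 := some_ne_zero _
  have hu : Wk (n + 1) ≠ 0 := by
    intro h0
    have e := (hzero (n + 1)).mpr h0
    rw [add_zsmul, hn, zero_add, one_zsmul] at e
    exact hP0 e
  have h33 : ((n : ℤ) = 3) → Wk 4 = -Wk 2 ^ 5 := by
    intro h3n
    exfalso
    have : n = 3 := by exact_mod_cast h3n
    rw [this] at h3
    norm_num at h3
  obtain ⟨α, β, hα, hβ, hαβ, hper⟩ :=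
    EllipticNet.exists_periodic net odd h1 (d := n) (by omega) hd hne hu h33
  rw [zpow_natCast] at hαβ
  have hperN : ∀ r : ℕ, Wk (n + r) = α * β ^ r * Wk r := fun r => by
    have e := hper r
    rwa [zpow_natCast] at e
  have hreflN : ∀ r : ℕ, r ≤ n → β ^ r * Wk ((n : ℤ) - r) = -(α * Wk r) := by
    intro r _
    have e := hper (-r)
    rw [← sub_eq_add_neg, zpow_neg, zpow_natCast, odd r] at e
    rw [e]
    field_simp
  let L := AlgebraicClosure F
  let ι := algebraMap F L
  have hn0 : 0 < n := by omega
  obtain ⟨θ, hθ⟩ := IsAlgClosed.exists_pow_nat_eq (ι (β ^ m / α)) hn0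
  have hια : ι α ≠ 0 := (map_ne_zero ι).mpr hα
  have hιβ : ι β ≠ 0 := (map_ne_zero ι).mpr hβ
  have hθ' : θ ^ n * ι α = ι β ^ m := by
    rw [hθ, map_div₀, map_pow, div_mul_cancel₀ _ hια]
  have hαβ' : ι α ^ 2 = ι β ^ n := by rw [← map_pow, hαβ, map_pow]
  have hper' : ∀ r : ℕ, (ι ∘ Wk) (n + r) = ι α * ι β ^ r * (ι ∘ Wk) r := fun r => by
    simp only [Function.comp_apply, hperN r, map_mul, map_pow]
  have hrefl' : ∀ r : ℕ, r ≤ n → ι β ^ r * (ι ∘ Wk) ((n : ℤ) - r) = -(ι α * (ι ∘ Wk) r) := by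
    intro r hr
    simp only [Function.comp_apply, ← map_pow, ← map_mul, hreflN r hr, map_neg]
  have h2 : Nat.Coprime 2 n := Nat.coprime_two_left.mpr ⟨m, hnm⟩
  have key := EllipticNet.prod_two_mul_pow_eq_of_root (W := ι ∘ Wk) hnm hια hιβ hαβ' hθ' hper'
    hrefl' h2 h3
  apply ι.injective
  simp only [map_mul, map_pow, map_prod]
  simpa only [Function.comp_apply] using key

/-- **`(Π_{k=1}^{m} ψ₂(kP)²)⁴ = (Π_{k=1}^{m} (x(kP) - x(2kP)))¹²`** for a point `P` of exact
order `n = 2m + 1` prime to `3` on a Weierstrass curve over a field (`ψ₂ = 2y + a₁x + a₃`):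
the product of `ψ₂` over a half-system of `⟨P⟩` is a cube up to a `4`-th root of unity, with cube
root `Π (x(kP) - x(2kP))`. (`ψ₂(kP) = ψ_{2k}/ψ_k⁴`, `x(kP) - x(2kP) = ψ_{3k}/(ψ_kψ_{2k}²)` and
`prod_ψ_two_mul_pow_eq`.) [cite: SilvermanAEC2009, Exercise 3.35(f) with Exercise 3.7(d)] -/
theorem prod_ψ₂_zsmul_sq_pow_four (h : V.toAffine.Nonsingular x₀ y₀) {n m : ℕ}
    (hnm : n = 2 * m + 1) (h3 : Nat.Coprime 3 n) (h1n : 1 < n) (hn : (n : ℤ) • some x₀ y₀ h = 0)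
    (hmin : ∀ k : ℕ, 0 < k → k < n → (k : ℤ) • some x₀ y₀ h ≠ 0) :
    (∏ k ∈ Icc 1 m, (2 * yOf ((k : ℤ) • some x₀ y₀ h) + V.a₁ * xOf ((k : ℤ) • some x₀ y₀ h) +
        V.a₃) ^ 2) ^ 4 =
      (∏ k ∈ Icc 1 m, (xOf ((k : ℤ) • some x₀ y₀ h) - xOf ((2 * k : ℤ) • some x₀ y₀ h))) ^ 12 := by
  have hzero : ∀ k : ℤ, k • some x₀ y₀ h = 0 ↔ (V.ψ k).evalEval x₀ y₀ = 0 :=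
    fun k => zsmul_some_eq_zero_iff h k
  have hψ : ∀ k ∈ Icc 1 m, (V.ψ (k : ℤ)).evalEval x₀ y₀ ≠ 0 := by
    intro k hk h0
    exact hmin k (by rw [mem_Icc] at hk; omega) (by rw [mem_Icc] at hk; omega) ((hzero k).mpr h0)
  have hψ₂ : ∀ k ∈ Icc 1 m, (V.ψ (2 * (k : ℤ))).evalEval x₀ y₀ ≠ 0 := by
    intro k hk h0
    rw [mem_Icc] at hk
    refine hmin (2 * k) (by omega) (by omega) ((hzero _).mpr ?_)
    push_cast
    exact h0
  have hT : ∀ k ∈ Icc 1 m,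
      2 * yOf ((k : ℤ) • some x₀ y₀ h) + V.a₁ * xOf ((k : ℤ) • some x₀ y₀ h) + V.a₃ =
        (V.ψ (2 * (k : ℤ))).evalEval x₀ y₀ / (V.ψ (k : ℤ)).evalEval x₀ y₀ ^ 4 := by
    intro k hk
    rw [eq_div_iff (pow_ne_zero 4 (hψ k hk))]
    exact ψ₂_zsmul_mul_pow_four h (hψ k hk)
  have hD : ∀ k ∈ Icc 1 m,
      xOf ((k : ℤ) • some x₀ y₀ h) - xOf ((2 * k : ℤ) • some x₀ y₀ h) =
        (V.ψ (3 * (k : ℤ))).evalEval x₀ y₀ /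
          ((V.ψ (k : ℤ)).evalEval x₀ y₀ * (V.ψ (2 * (k : ℤ))).evalEval x₀ y₀ ^ 2) := by
    intro k hk
    rw [eq_div_iff (mul_ne_zero (hψ k hk) (pow_ne_zero 2 (hψ₂ k hk)))]
    exact xOf_zsmul_sub_mul h (hψ k hk) (hψ₂ k hk)
  have key := prod_ψ_two_mul_pow_eq h hnm h3 h1n hn hmin
  simp only [Nat.cast_mul, Nat.cast_ofNat] at key
  have hA : ∏ k ∈ Icc 1 m, (V.ψ (2 * (k : ℤ))).evalEval x₀ y₀ ≠ 0 := prod_ne_zero_iff.mpr hψ₂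
  have hC : ∏ k ∈ Icc 1 m, (V.ψ (k : ℤ)).evalEval x₀ y₀ ≠ 0 := prod_ne_zero_iff.mpr hψ
  have eL : ∏ k ∈ Icc 1 m, (2 * yOf ((k : ℤ) • some x₀ y₀ h) + V.a₁ * xOf ((k : ℤ) • some x₀ y₀ h) +
      V.a₃) ^ 2 = ((∏ k ∈ Icc 1 m, (V.ψ (2 * (k : ℤ))).evalEval x₀ y₀) /
        (∏ k ∈ Icc 1 m, (V.ψ (k : ℤ)).evalEval x₀ y₀) ^ 4) ^ 2 := by
    rw [prod_pow, prod_congr rfl hT, prod_div_distrib, prod_pow]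
  have eR : ∏ k ∈ Icc 1 m, (xOf ((k : ℤ) • some x₀ y₀ h) - xOf ((2 * k : ℤ) • some x₀ y₀ h)) =
      (∏ k ∈ Icc 1 m, (V.ψ (3 * (k : ℤ))).evalEval x₀ y₀) /
        ((∏ k ∈ Icc 1 m, (V.ψ (k : ℤ)).evalEval x₀ y₀) *
          (∏ k ∈ Icc 1 m, (V.ψ (2 * (k : ℤ))).evalEval x₀ y₀) ^ 2) := by
    rw [prod_congr rfl hD, prod_div_distrib, prod_mul_distrib, prod_pow]
  rw [eL, eR, div_pow, div_pow, div_pow,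
    div_eq_div_iff (pow_ne_zero _ (pow_ne_zero _ (pow_ne_zero _ hC)))
      (pow_ne_zero _ (mul_ne_zero hC (pow_ne_zero _ hA)))]
  linear_combination (∏ k ∈ Icc 1 m, (V.ψ (k : ℤ)).evalEval x₀ y₀) ^ 12 * key

end Order

/-! ### The cyclic kernel `⟨P⟩` as an odd subgroup finset, and Coates' lemma -/

section Kernel

variable {F : Type*} [Field F] {V : WeierstrassCurve F} {x₀ y₀ : F}

/-- `jP = (j mod n)P` when `nP = O`. Private plumbing. [folklore] -/
private theorem natCast_zsmul_eq_mod (h : V.toAffine.Nonsingular x₀ y₀) {n : ℕ}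
    (hn : (n : ℤ) • some x₀ y₀ h = 0) (j : ℕ) :
    (j : ℤ) • some x₀ y₀ h = ((j % n : ℕ) : ℤ) • some x₀ y₀ h := by
  conv_lhs => rw [← Nat.div_add_mod j n]
  push_cast
  rw [add_zsmul, mul_comm, mul_zsmul, hn, zsmul_zero, zero_add]

/-- Injectivity of `k ↦ kP` below the order. Private plumbing. [folklore] -/
private theorem zsmul_injOn (h : V.toAffine.Nonsingular x₀ y₀) {n : ℕ}
    (hmin : ∀ k : ℕ, 0 < k → k < n → (k : ℤ) • some x₀ y₀ h ≠ 0) :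
    Set.InjOn (fun k : ℕ => (k : ℤ) • some x₀ y₀ h) (range n : Finset ℕ) := by
  intro a ha b hb hab
  simp only [coe_range, Set.mem_Iio] at ha hb
  simp only at hab
  by_contra hne
  rcases Nat.lt_or_gt_of_ne hne with hlt | hlt
  · refine hmin (b - a) (by omega) (by omega) ?_
    rw [Nat.cast_sub hlt.le, sub_zsmul, hab]
    simp
  · refine hmin (a - b) (by omega) (by omega) ?_
    rw [Nat.cast_sub hlt.le, sub_zsmul, hab]
    simp

/-- **`⟨P⟩ = {kP : 0 ≤ k < n}` is a finite subgroup without `2`-torsion** for a point `P` of exact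
odd order `n`. [cite: SilvermanAEC2009, III.4.12 (finite subgroups as kernels)] -/
theorem isOddSubgroupFinset_zmultiples (h : V.toAffine.Nonsingular x₀ y₀) {n m : ℕ}
    (hnm : n = 2 * m + 1) (hn : (n : ℤ) • some x₀ y₀ h = 0)
    (hmin : ∀ k : ℕ, 0 < k → k < n → (k : ℤ) • some x₀ y₀ h ≠ 0) :
    IsOddSubgroupFinset ((range n).image fun k : ℕ => (k : ℤ) • some x₀ y₀ h) := by
  have hn0 : 0 < n := by omega
  have hmem : ∀ j : ℕ, (j : ℤ) • some x₀ y₀ h ∈ (range n).image fun k : ℕ => (k : ℤ) • some x₀ y₀ h :=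
    fun j => mem_image.mpr ⟨j % n, mem_range.mpr (Nat.mod_lt j hn0), (natCast_zsmul_eq_mod h hn j).symm⟩
  refine ⟨?_, ?_, ?_, ?_⟩
  · exact mem_image.mpr ⟨0, mem_range.mpr hn0, by simp⟩
  · intro u hu v hv
    obtain ⟨a, -, rfl⟩ := mem_image.mp hu
    obtain ⟨b, -, rfl⟩ := mem_image.mp hv
    rw [← add_zsmul, ← Nat.cast_add]
    exact hmem (a + b)
  · intro v hv
    obtain ⟨a, ha, rfl⟩ := mem_image.mp hv
    rw [mem_range] at ha
    have e : ((n - a : ℕ) : ℤ) • some x₀ y₀ h = -((a : ℤ) • some x₀ y₀ h) := by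
      rw [Nat.cast_sub ha.le, sub_zsmul, hn]
      simp
    rw [← e]
    exact hmem (n - a)
  · intro v hv hneg
    obtain ⟨a, ha, rfl⟩ := mem_image.mp hv
    rw [mem_range] at ha
    have h2 : ((2 * a : ℕ) : ℤ) • some x₀ y₀ h = 0 := by
      rw [Nat.cast_mul, Nat.cast_ofNat, mul_zsmul, two_zsmul]; nth_rw 1 [← hneg]; rw [neg_add_cancel]
    rw [natCast_zsmul_eq_mod h hn] at h2
    have hmod : 2 * a % n = 0 := by
      by_contra hne
      exact hmin _ (Nat.pos_of_ne_zero hne) (Nat.mod_lt _ hn0) h2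
    have hdvd : n ∣ a := by
      have : n ∣ 2 * a := Nat.dvd_of_mod_eq_zero hmod
      exact (Nat.coprime_two_left.mpr ⟨m, hnm⟩).symm.dvd_of_dvd_mul_left this
    rcases Nat.eq_zero_or_pos a with rfl | hapos
    · simp
    · exact absurd (Nat.le_of_dvd hapos hdvd) (by omega)

/-- `#⟨P⟩ = n`. [cite: SilvermanAEC2009, III.4.12] -/
theorem card_image_zsmul (h : V.toAffine.Nonsingular x₀ y₀) {n : ℕ}
    (hmin : ∀ k : ℕ, 0 < k → k < n → (k : ℤ) • some x₀ y₀ h ≠ 0) :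
    ((range n).image fun k : ℕ => (k : ℤ) • some x₀ y₀ h).card = n := by
  rw [card_image_of_injOn (zsmul_injOn h hmin), card_range]

/-- **The product of `(2y)⁴` over `⟨P⟩ ∖ O` is the `4`-th power of the product of `(2y)²` over a
half-system** (`y(-v) = -y(v)` on a short model). [cite: SilvermanAEC2009, III.2.3] -/
theorem prod_image_zsmul_erase_zero [V.IsShortNF] (h : V.toAffine.Nonsingular x₀ y₀) {n m : ℕ}
    (hnm : n = 2 * m + 1) (hn : (n : ℤ) • some x₀ y₀ h = 0)
    (hmin : ∀ k : ℕ, 0 < k → k < n → (k : ℤ) • some x₀ y₀ h ≠ 0) :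
    ∏ v ∈ ((range n).image fun k : ℕ => (k : ℤ) • some x₀ y₀ h).erase 0, (2 * yOf v) ^ 4 =
      (∏ k ∈ Icc 1 m, (2 * yOf ((k : ℤ) • some x₀ y₀ h)) ^ 2) ^ 4 := by
  set f : ℕ → V.toAffine.Point := fun k => (k : ℤ) • some x₀ y₀ h with hf
  have hker : ((range n).image f).erase 0 = (Ico 1 n).image f := by
    ext v
    simp only [mem_erase, mem_image, mem_range, mem_Ico]
    constructor
    · rintro ⟨hv0, a, ha, rfl⟩
      refine ⟨a, ⟨?_, ha⟩, rfl⟩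
      by_contra ha0
      have : a = 0 := by omega
      exact hv0 (by rw [this, hf]; simp)
    · rintro ⟨a, ⟨ha1, ha⟩, rfl⟩
      exact ⟨hmin a (by omega) ha, a, ha, rfl⟩
  have hinj : Set.InjOn f (Ico 1 n : Finset ℕ) := fun a ha b hb hab =>
    zsmul_injOn h hmin (by simp only [coe_Ico, Set.mem_Ico, coe_range, Set.mem_Iio] at ha ⊢; exact ha.2)
      (by simp only [coe_Ico, Set.mem_Ico, coe_range, Set.mem_Iio] at hb ⊢; exact hb.2) hab
  rw [hker, prod_image hinj]
  have hsplit := prod_Ico_consecutive (fun k => (2 * yOf (f k)) ^ 4) (show 1 ≤ m + 1 by omega)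
    (show m + 1 ≤ n by omega)
  rw [← hsplit]
  have hrefl : ∏ k ∈ Ico (m + 1) n, (2 * yOf (f k)) ^ 4 = ∏ k ∈ Ico 1 (m + 1), (2 * yOf (f k)) ^ 4 := by
    have hr := prod_Ico_reflect (fun k => (2 * yOf (f k)) ^ 4) 1 (show m + 1 ≤ n + 1 by omega)
    rw [show n + 1 - (m + 1) = m + 1 by omega, show n + 1 - 1 = n by omega] at hr
    rw [← hr]
    refine prod_congr rfl fun k hk => ?_
    rw [mem_Ico] at hk
    have e : f (n - k) = -f k := by
      simp only [hf]
      rw [Nat.cast_sub (show k ≤ n by omega), sub_zsmul, hn]; simp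
    simp only [e, yOf_neg]; ring
  have hI : Ico 1 (m + 1) = Icc 1 m := by ext k; simp only [mem_Ico, mem_Icc]; omega
  rw [hrefl, hI, ← pow_two, ← prod_pow, ← prod_pow]
  exact prod_congr rfl fun k _ => by ring

/-- **Coates' lemma in Vélu form (Dokchitser–Dokchitser 2015, Thm. 3, every cyclic kernel of
order prime to `6`).** Let `E : y² = x³ + a₄x + a₆` be a short Weierstrass elliptic curve over a
field `F` of characteristic `0`, `P = (x₀, y₀) ∈ E(F)` a point of exact order `n = 2m + 1` with
`3 ∤ n` (`nP = O`, `kP ≠ O` for `0 < k < n`), `G = ⟨P⟩` and `E/G : y² = x³ + a'x + b'` Vélu's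
quotient (`a' = veluA G`, `b' = veluB G`). Then
`Δ(E/G) · (Π_{k=1}^{m} (x(kP) - x(2kP)))¹² = Δ(E)ⁿ`; in particular `Δ(E)ⁿ/Δ(E/G)` is a `12`-th
power in `F` (and in the field of definition of the GROUP `G`, the product being a symmetric
function of the kernel). Printed for `n = p > 3` prime and proved there analytically
(`η`-quotients); here algebraic, from `Δ(E/G)·Π_{v ≠ O}(2y(v))⁴ = Δ(E)ⁿ`
(`veluDelta_mul_prod_pow_four`) and `(Π_{k ≤ m}(2y(kP))²)⁴ = (Π_{k ≤ m}(x(kP) - x(2kP)))¹²`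
(`prod_ψ₂_zsmul_sq_pow_four`).
[cite: DokchitserDokchitser2015LocalInvariants, §2 Thm. 3 (Coates: `Δ^p/Δ'` is a 12th power)] -/
theorem veluDelta_mul_prod_sub_pow_twelve {F : Type*} [Field F] [CharZero F] (W : WeierstrassCurve F)
    [W.IsShortNF] [W.IsElliptic] {x₀ y₀ : F} (h : (W⁄F).toAffine.Nonsingular x₀ y₀) {n m : ℕ}
    (hnm : n = 2 * m + 1) (h3 : Nat.Coprime 3 n) (h1n : 1 < n) (hn : (n : ℤ) • some x₀ y₀ h = 0)
    (hmin : ∀ k : ℕ, 0 < k → k < n → (k : ℤ) • some x₀ y₀ h ≠ 0) :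
    (⟨0, 0, 0, veluA ((range n).image fun k : ℕ => (k : ℤ) • some x₀ y₀ h),
        veluB ((range n).image fun k : ℕ => (k : ℤ) • some x₀ y₀ h)⟩ : WeierstrassCurve F).Δ *
      (∏ k ∈ Icc 1 m, (xOf ((k : ℤ) • some x₀ y₀ h) - xOf ((2 * k : ℤ) • some x₀ y₀ h))) ^ 12 =
      W.Δ ^ n := by
  have hG := isOddSubgroupFinset_zmultiples h hnm hn hmin
  have hΔ := WeierstrassCurve.veluDelta_mul_prod_pow_four W hG
  rw [card_image_zsmul h hmin, prod_image_zsmul_erase_zero h hnm hn hmin] at hΔ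
  have hcube := prod_ψ₂_zsmul_sq_pow_four h hnm h3 h1n hn hmin
  simp only [WeierstrassCurve.a₁_of_isShortNF, WeierstrassCurve.a₃_of_isShortNF, zero_mul,
    add_zero] at hcube
  rw [hcube] at hΔ
  exact hΔ

end Kernel

end WeierstrassCurve.Affine.Point
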